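import Summits.BirchSwinnertonDyer.BirchSwinnertonDyer.Theorems.PrintCf2SplitBadTwoKummerTowerProNullAtV
import Literature.NumberTheory.GaloisCohomology.ShaOneMuRat
import Literature.NumberTheory.GaloisRepresentations.TateModuleKummerCompletion
import HarnessLib

/-!
# Crux `PrintCf2.SplitBadTwoRankOneOfFacts` (stmt-BirchSwinnertonDyer-20368), S3n′-FACT-FREE road, brick R1′ (first half, θ = 1):
# (R1) READ IN `H¹(F, μ_{p^k})` — Kummer classes strict above `v` and unramified-in-valuation away from `v` DIE in the tower

Cell `bsd-print-cf2`, WIDTH seat `bsd-line-cf2-p1-w2` g14 (prover-bsd-line-cf2-p1-w2-g14-0); `--supports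
stmt-BirchSwinnertonDyer-20368` (helper, Theses-free). HONEST FRAMING: nothing here closes the crux or a registered stub;
BSD is not proved by any of this; no summit statement is proved by this seat. No definition, no named fact, no `sorry`.
UNCONDITIONAL (inputs: `KummerProNull.exists_level_forall_exists_pow_eq_of_local` = (R1), p696581; the tree's Kummer theory
`GaloisCohomologyKummerProofs` and the local bridge `ShaOneMuRat.exists_eq_pow_of_pullback_kummerMap_eq_zero`).

WHAT (memo `Cruxes/SplitBadTwoRankOneOfFacts/S3N-FACTFREE-w2g14.md` §3/§7, the (PRO-NULL) input of the level lift in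
cohomological currency at the places above `v`, trivial character): `K` imaginary quadratic, `p = v v̄` split, `F ⊆ K̄` finite
abelian over `K`.
* `exists_level_kummerMap_eq_one_of_localization_eq_zero` — ∀ k ∃ M ≥ k: every `a ∈ F^×` whose valuations away from `v` are
  divisible by `p^M` and whose Kummer class `δ_{p^M}(a) ∈ H¹(F, μ_{p^M})` LOCALISES TO ZERO at every place above `v` has TRIVIAL
  Kummer class `δ_{p^k}(a) = 0` in `H¹(F, μ_{p^k})`;
* `exists_level_red_kummerMap_eq_zero_of_localization_eq_zero` — the same conclusion read as «the image of `δ_{p^M}(a)` under the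
  transition map `H¹(F, μ_{p^M}) → H¹(F, μ_{p^k})` (`muSystem.redHom`, `ζ ↦ ζ^{p^{M−k}}`) vanishes»
  (`TateModuleKummerCompletion.kummerMap_red_compat`): the dual Kummer–Selmer tower is PRO-NULL.
The condition at `w ∤ v` is kept in valuation form (`p^M ∣ log v_w(a)`); its translation from «`δ(a)` unramified at `w`» is the
second half of R1′ (tree: `EllipticCurves/KummerUnramified`, over `F(μ_{p^M})` and descent — `F` itself need not contain `μ_{p^M}`).
beyond-print theorem: no. presearch: memo §5.

References: J.-P. Serre, *Galois Cohomology* II §1.2 (Kummer); E. de Shalit (1987) III.2.3; R. Greenberg, LNM 1716 §4.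
-/

noncomputable section

set_option linter.dupNamespace false
set_option autoImplicit false

open scoped Classical
open NumberField IsDedekindDomain Field
open Literature.NumberTheory.EllipticCurves Literature.NumberTheory.GaloisRepresentations
open Literature.NumberTheory.GaloisCohomology

namespace Summit.BirchSwinnertonDyer.BirchSwinnertonDyer.Theorems.PrintCf2.KummerProNull

variable {K : Type} [Field K] [NumberField K] {p : ℕ} [Fact p.Prime]

/-- **(R1) in `H¹(F, μ)`-currency (θ = 1).** For every `k` there is `M ≥ k` such that for every `a ∈ F^×` with `p^M ∣ log v_w(a)` at
all finite `w ∤ v` and `loc_w δ_{p^M}(a) = 0` in `H¹(F_w, μ_{p^M})` at all `w ∣ v`, the Kummer class `δ_{p^k}(a) ∈ H¹(F, μ_{p^k})` is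
trivial. [cite: SerreGaloisCohomology1997, II §1.2] [cite: deShalit1987, III.2.3 (Theorem (Baker–Brumer))] -/
theorem exists_level_kummerMap_eq_one_of_localization_eq_zero (hK : IsImaginaryQuadratic K)
    {v vbar : HeightOneSpectrum (𝓞 K)} (hv : ((p : ℕ) : 𝓞 K) ∈ v.asIdeal) (hvbar : ((p : ℕ) : 𝓞 K) ∈ vbar.asIdeal)
    (hne : vbar ≠ v) (F : IntermediateField K (AlgebraicClosure K)) [FiniteDimensional K F] [IsAbelianGalois K F]
    [NumberField F] (k : ℕ) :
    ∃ M : ℕ, k ≤ M ∧ ∀ a : (F : Type)ˣ,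
      (∀ w : HeightOneSpectrum (𝓞 F), w.under (𝓞 K) ≠ v →
        ((p ^ M : ℕ) : ℤ) ∣ WithZero.log (w.valuation F (a : F))) →
      (∀ w : v.Extension (𝓞 F),
        galoisCohomology.localization (DiscreteGaloisModule.mu F (p ^ M)) (Sum.inr w.1) 1
          (Multiplicative.toAdd (kummerMap F (p ^ M) a)) = 0) →
      kummerMap F (p ^ k) a = 1 := by
  have hp : p.Prime := Fact.out
  obtain ⟨M, hkM, hM⟩ := exists_level_forall_exists_pow_eq_of_local (p := p) hK hv hvbar hne F k
  refine ⟨M, hkM, fun a hdiv hloc ↦ ?_⟩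
  haveI : NeZero ((p ^ M : ℕ) : F) := ⟨by exact_mod_cast pow_ne_zero M hp.ne_zero⟩
  haveI : NeZero ((p ^ k : ℕ) : F) := ⟨by exact_mod_cast pow_ne_zero k hp.ne_zero⟩
  -- at every `w ∣ v`, `a` is a `p^M`-th power in `F_w`
  have hloc' : ∀ w : v.Extension (𝓞 F), ∃ y : w.1.adicCompletion F,
      y ^ p ^ M = algebraMap F (w.1.adicCompletion F) (a : F) := by
    intro w
    haveI : CharZero (w.1.adicCompletion F) :=
      charZero_of_injective_algebraMap (algebraMap F (w.1.adicCompletion F)).injective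
    obtain ⟨c, hc⟩ := @exists_eq_pow_of_pullback_kummerMap_eq_zero F (w.1.adicCompletion F) _ _
      (HeightOneSpectrum.instAlgebraAdicCompletion (𝓞 F) F w.1) _ (p ^ M) _ a (hloc w)
    exact ⟨c, hc.symm⟩
  -- (R1): `a` is a `p^k`-th power in `F`
  obtain ⟨y, hy⟩ := hM (a : F) a.ne_zero hdiv hloc'
  have hy0 : y ≠ 0 := by
    intro h0
    rw [h0, zero_pow (pow_ne_zero k hp.ne_zero)] at hy
    exact a.ne_zero hy.symm
  have hmem : a ∈ (powMonoidHom (p ^ k) : (F : Type)ˣ →* (F : Type)ˣ).range :=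
    ⟨Units.mk0 y hy0, Units.ext (by rw [powMonoidHom_apply, Units.val_pow_eq_pow_val, Units.val_mk0, hy])⟩
  exact (MonoidHom.mem_ker).mp (range_powMonoidHom_le_ker_kummerMap F (p ^ k) hmem)

/-- **(PRO-NULL) of the Kummer tower, transition-map form (θ = 1).** Same hypotheses; conclusion: the image of `δ_{p^M}(a)` under
the transition map `H¹(F, μ_{p^M}) → H¹(F, μ_{p^k})` of the system `(μ_{p^j})_j` (`muSystem F`, `ζ ↦ ζ^{p^{M−k}}`) is `0`.
[cite: SerreGaloisCohomology1997, II §1.2] [cite: deShalit1987, III.2.3 (Theorem (Baker–Brumer))] -/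
theorem exists_level_red_kummerMap_eq_zero_of_localization_eq_zero (hK : IsImaginaryQuadratic K)
    {v vbar : HeightOneSpectrum (𝓞 K)} (hv : ((p : ℕ) : 𝓞 K) ∈ v.asIdeal) (hvbar : ((p : ℕ) : 𝓞 K) ∈ vbar.asIdeal)
    (hne : vbar ≠ v) (F : IntermediateField K (AlgebraicClosure K)) [FiniteDimensional K F] [IsAbelianGalois K F]
    [NumberField F] (k : ℕ) :
    ∃ M : ℕ, k ≤ M ∧ ∀ a : (F : Type)ˣ,
      (∀ w : HeightOneSpectrum (𝓞 F), w.under (𝓞 K) ≠ v →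
        ((p ^ M : ℕ) : ℤ) ∣ WithZero.log (w.valuation F (a : F))) →
      (∀ w : v.Extension (𝓞 F),
        galoisCohomology.localization (DiscreteGaloisModule.mu F (p ^ M)) (Sum.inr w.1) 1
          (Multiplicative.toAdd (kummerMap F (p ^ M) a)) = 0) →
      ∀ hle : (muSystem F).le ⟨p ^ k, pow_pos (Fact.out : p.Prime).pos k⟩ ⟨p ^ M, pow_pos (Fact.out : p.Prime).pos M⟩,
        cohomologyMap ((muSystem F).redHom hle) 1
          (Multiplicative.toAdd (kummerMap F (p ^ M) a)) = 0 := by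
  obtain ⟨M, hkM, hM⟩ := exists_level_kummerMap_eq_one_of_localization_eq_zero (p := p) hK hv hvbar hne F k
  refine ⟨M, hkM, fun a hdiv hloc hle ↦ ?_⟩
  have h := kummerMap_red_compat (K := F) (n := ⟨p ^ k, pow_pos (Fact.out : p.Prime).pos k⟩)
    (m := ⟨p ^ M, pow_pos (Fact.out : p.Prime).pos M⟩) hle a
  have h1 : kummerMap F (p ^ k) a = 1 := hM a hdiv hloc
  have h2 : Multiplicative.toAdd (kummerMap F ((⟨p ^ k, pow_pos (Fact.out : p.Prime).pos k⟩ : ℕ+) : ℕ) a) = 0 := by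
    change Multiplicative.toAdd (kummerMap F (p ^ k) a) = 0
    rw [h1]
    rfl
  exact h.trans h2

end Summit.BirchSwinnertonDyer.BirchSwinnertonDyer.Theorems.PrintCf2.KummerProNull

end
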